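import Literature.NumberTheory.Sieve.LinearEquationsInPrimesPseudorandom
import Mathlib.Geometry.Manifold.Algebra.LieGroup
import Mathlib.Geometry.Manifold.Instances.UnitsOfNormedAlgebra
import Mathlib.AlgebraicTopology.FundamentalGroupoid.SimplyConnected
import Mathlib.Topology.Homotopy.Contractible
import Mathlib.Analysis.Convex.Contractible
import Mathlib.GroupTheory.Nilpotent
import Mathlib.Topology.Algebra.Group.Quotient
import Mathlib.Topology.Instances.ZMultiples
import Mathlib.Analysis.Normed.Group.AddCircle
import HarnessLib

/-!
# Linear equations in primes: nilsequences and the Gowers uniformity estimate (Green–Tao 2010, §§8, 10)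

Trunk T-SIEVE (`Literature/NumberTheory/Sieve`). First layer of the decomposition of the named fact
`Literature.NumberTheory.Sieve.GreenTao2010_gowersUniformity` (B. Green, T. Tao, *Linear equations
in primes*, Ann. of Math. 171 (2010), Thm. 7.2: `‖Λ'_{b,W} - 1‖_{U^{s+1}[N]} = o(1)`), which after
`LinearEquationsInPrimesEnvelopingSieveDomination.lean` is the one remaining input of the
Green–Tao–Ziegler theorem `GreenTaoZiegler2012_finiteComplexity` in this tree. The paper proves
Thm. 7.2 in §10 in two sentences (the paragraph between Prop. 10.1 and Prop. 10.2): "In view of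
Proposition 10.1 and Proposition 6.4, it is not hard to see that Theorem 7.2, and hence the Main
Theorem, follows from the next proposition. All one need do is choose
`C := max(C₀((s+2)2^{s+1}), 20)`, where `C₀` is the function appearing in Proposition 6.4." This
file vendors the vocabulary of §8 that Mathlib lacks, states the two propositions (as
predicates of their parameters — they are NOT asserted here, see "Debt discipline" below), and
PROVES that deduction, level by level in `s`:

* `Literature.NumberTheory.Sieve.Nilmanifold s` — Def. 8.1: an `s`-step nilmanifold
  `G/Γ = (G/Γ, d_{G/Γ})`: a connected, simply connected Lie group `G` (Mathlib's `LieGroup`,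
  modelled on a finite-dimensional real normed space) with `G_{s+1} = {1}` for the lower central
  series, a discrete cocompact subgroup `Γ`, and a metric `d_{G/Γ}` on `G/Γ` (see the design notes);
  `Nilmanifold.nilsequence` (the `s`-step nilsequence `n ↦ F(gⁿ x)`),
  `Nilmanifold.IsBoundedLipschitz M F` ("`1`-bounded, with Lipschitz constant at most `M`"),
  `Nilmanifold.orbitAverage` (the correlation `𝔼_{n ∈ [N]} a(n) F(gⁿ x)`), the one-point
  nilmanifold `Nilmanifold.point` (`G = ℝ⁰`; the structure is inhabited for every `s`) and the
  circle `Nilmanifold.circle : Nilmanifold 1` (`G = ℝ`, `Γ = ℤ`, `G/Γ = ℝ/ℤ` with the metric of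
  `AddCircle 1`; its nilsequences are `n ↦ F(x₀ + nθ)`, `nilsequence_circle`) — the nilmanifold
  of `GI(1)` ("one can take `G/Γ` to just be the standard unit circle `ℝ/ℤ`");
* `Literature.NumberTheory.Sieve.GreenTao2010_relativeInverseAt s δ C A` — the assertion of
  Prop. 10.1, the relative inverse Gowers-norm theorem (the inverse conjecture `GI(s)` transferred
  to functions bounded by a pseudorandom measure; proved in §10 from `GI(s)`, which is
  Green–Tao–Ziegler 2012, Thm. 1.3), for the parameters `s`, `δ`, `C` and moment constants `A`;
* `Literature.NumberTheory.Sieve.GreenTao2010_nilsequenceOrthogonalityAt s X M` — the assertion of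
  Prop. 10.2, "`W`-tricked von Mangoldt orthogonal to nilsequences":
  `𝔼_{n ∈ [N]} (Λ'_{b,W}(n) - 1) F(gⁿ x) = o_{M,G/Γ,s}(1)` (proved in §§11–12 and App. D from the
  Möbius–nilsequences conjecture `MN(s)`, which is Green–Tao 2012, Thm. 1.1), for the nilmanifold
  `X = G/Γ` and the Lipschitz bound `M`;
* `Literature.NumberTheory.Sieve.GreenTao2010_gowersUniformityAt_of_props` (PROVED): at each level
  `s ≥ 1`, Prop. 6.4 (`GreenTao2010_pseudorandomDomination`, a theorem of this tree,
  `…EnvelopingSieveDomination.lean`), Prop. 10.1 (all `δ, C, A`) and Prop. 10.2 (all `G/Γ, M`)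
  imply Thm. 7.2 at level `s` (`GreenTao2010_gowersUniformityAt s`: range-uniform in the cutoff
  `w`, uniform in `b`); hence `GreenTao2010_gowersUniformity_of_props` for all `s ≥ 1`.

## Debt discipline (D-0026)

Props. 10.1 and 10.2 are genuine published theorems (given `GI(s)`, `MN(s)`), each far beyond an
inline proof (the first is the transference of the 140-page inverse theorem of
Green–Tao–Ziegler, the second is §§11–12 plus App. D–E of the paper on top of Green–Tao 2012).
This file therefore does not assert them: it defines the predicates `…At` (the printed
statements with their parameters pulled out) and proves the deduction of Thm. 7.2 from them as an
honest conditional theorem. Vendoring the closed statements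
`∀ s ≥ 1, ∀ δ C A, GreenTao2010_relativeInverseAt s δ C A` and
`∀ s ≥ 1, ∀ X M, GreenTao2010_nilsequenceOrthogonalityAt s X M` as named facts, and with them
`GreenTao2010_gowersUniformity_holds`, is requested through the split path (session notes).

## The proof of Thm. 7.2 from Props. 6.4, 10.1, 10.2 (as formalised)

Fix `s ≥ 1` and `ε > 0`; let `D = (s+2)2^{s+1}`, `C₀ = C₀(D)` (Prop. 6.4 with `t = 1`),
`C = max(C₀, 20)`, and let `M`, `A` be the domination and moment constants of Prop. 6.4. Apply
Prop. 10.1 with `δ = min(ε/2M, 1)`: a finite family `(G_i/Γ_i)_{i < m}`, a Lipschitz bound, a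
correlation bound `c > 0`, a pseudorandomness error `η` and a threshold. Apply Prop. 10.2 to each
member of the family with tolerance `cM/4`, and Prop. 6.4 with error `η`; take `w₀`, `N₀` beyond
all thresholds. Given `N ≥ N₀`, an admissible `w` and `b`, suppose
`‖Λ'_{b,W} - 1‖_{U^{s+1}[N]} > ε`. Pick a prime `N' ∈ [CN, 2CN]` (Bertrand) and the measure `ν` of
Prop. 6.4, so that `1 + Λ'_{b,W} ≤ M ν` on `[N^{3/5}, N]`; the function
`f = M⁻¹ (Λ'_{b,W} - 1) 1_{[⌈N^{3/5}⌉, N]}` then satisfies `|f| ≤ ν` on `[N]` (Prop. 6.4 dominates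
only on `[N^{3/5}, N]`, a point the printed proof leaves implicit; the cut moves the Gowers
average by `O_s((log N / M)^{2^{s+1}} N^{-2/5})`, `norm_uniformityAvg_sub_le`), and
`‖f‖_{U^{s+1}[N]} ≥ ε/M - ε/2M ≥ δ`. Prop. 10.1 gives `i, g, x, F` with
`|𝔼_{n ≤ N} f(n) F(gⁿ x)| ≥ c`, while Prop. 10.2 gives `|𝔼_{n ≤ N} (Λ'_{b,W}(n) - 1) F(gⁿ x)| ≤ cM/4`
and the cut contributes at most `⌈N^{3/5}⌉ (1 + 2 log(N+1)) / (MN) ≤ c/4`: so `c ≤ c/2`,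
a contradiction.

## Design choices

* **Nilmanifolds (Def. 8.1).** "Let `G` be a connected, simply connected, Lie group … `s`-step
  nilpotent … Let `Γ ⊆ G` be a discrete, cocompact subgroup. Then the quotient `G/Γ` is called an
  `s`-step nilmanifold." This is rendered verbatim with Mathlib's classes: `ChartedSpace E G`,
  `IsManifold 𝓘(ℝ, E) ∞ G`, `LieGroup 𝓘(ℝ, E) ∞ G` for a finite-dimensional real normed space `E`
  (a finite-dimensional real Lie group; `T2Space G` is recorded explicitly since Mathlib's
  manifolds need not be Hausdorff, although for locally Euclidean groups it is automatic),
  `ConnectedSpace G`, `SimplyConnectedSpace G`, `(⊤ : Subgroup G).lowerCentralSeries s = ⊥`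
  (Green–Tao's `G_{i+1} = [G, G_i]`, `G_1 = G`, is Mathlib's `lowerCentralSeries` shifted by one,
  so "`G_{s+1} = {1}`" is the displayed condition), `DiscreteTopology Γ`, `CompactSpace (G ⧸ Γ)` for
  the quotient topology. The data are bundled in a structure (`Type 1`, carriers in `Type`) so
  that "a finite collection of nilmanifolds" is a map `Fin m → Nilmanifold s`; `G` acts on `G ⧸ Γ`
  by left multiplication (Mathlib's `MulAction G (G ⧸ Γ)`), and a nilsequence is `n ↦ F(gⁿ • x)`.
  Groups are written multiplicatively (Mathlib's nilpotency theory is multiplicative), so the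
  additive examples `ℝ`, `ℝ/ℤ` enter through `Multiplicative ℝ`, all structure (charts, smoothness
  of the group law, simple connectedness, discreteness of `ℤ`, compactness and metric of `ℝ/ℤ`)
  being transported from Mathlib's additive statements by definitional unfolding (`circle`).
  (In Mathlib `LieGroup` already includes the `IsManifold` compatibility of the atlas; the
  separate `IsManifold` field is kept for legibility and is logically redundant.)
* **The metric.** Green–Tao "arbitrarily endow each nilmanifold `G/Γ` with a smooth Riemannian
  metric `d_{G/Γ}`" and measure the regularity of `F` by its Lipschitz constant, remarking that the
  choice only affects constants and that "one could replace the Lipschitz constant here by other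
  quantitative measures of regularity". Mathlib has no quotient manifolds `G/Γ`, so the structure
  carries instead an explicit metric `dist` on `G ⧸ Γ` *inducing the quotient topology*
  (`isOpen_iff`). For the two propositions below this is harmless: in Prop. 10.1 the family and its
  metrics are existentially quantified (a smooth Riemannian metric is a particular compatible
  metric, so the rendering is implied by the printed statement), and Prop. 10.2 is a rate-free
  `o(1)` statement whose rate may depend on `(G/Γ, d_{G/Γ}, M)`: for a compatible metric `d'` the
  ball `{F : |F| ≤ 1, Lip_{d'}(F) ≤ M}` is compact in `C(G/Γ)` (Arzelà–Ascoli), every continuous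
  `F` is uniformly approximable by smooth — hence `d_{G/Γ}`-Lipschitz — functions, and
  `𝔼_{n ∈ [N]} |Λ'_{b,W}(n) - 1| = O(1)` (Brun–Titchmarsh), so the printed Prop. 10.2 for one
  smooth Riemannian metric gives it for every compatible metric on the same `G/Γ` (the proof of
  Prop. 11.2 opens with exactly this compactness argument). CAVEAT for later layers: this
  equivalence fails for statements with explicit rates such as `MN(s)` with its `log^{-A} N`
  saving (used in §12), which must be vendored for the Riemannian/Mal'cev Lipschitz class
  (Green–Tao 2012, Thm. 1.1 is stated with Mal'cev-basis metrics); that is why `GI(s)` and `MN(s)`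
  themselves are deliberately NOT vendored here.
* **Quantitative rendering** (as in `LinearEquationsInPrimesPseudorandom.lean`): pseudorandomness
  carries an explicit error `η` and moment constants `A` (`IsPseudorandomMeasure D η A ν`), so
  Prop. 10.1 ("≫_{s,C,δ} 1" for a `(s+2)2^{s+1}`-pseudorandom `ν`) becomes: for all `s, δ, C ≥ 20`
  and `A` there are a finite family, a Lipschitz bound, `c > 0`, an admissible error `η > 0` and a
  threshold `N₀` (the printed "Let `N ≥ 1`" with genuinely `o(1)`-pseudorandom `ν`; the threshold
  form is implied by it); all constants may depend on `A` as well. Prop. 10.2's `o_{M,G/Γ,s}(1)` is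
  uniform in `g, x` (as stressed for `MN(s)`, Remark after Conj. 8.5), in `b` (Remark after
  Thm. 5.1) and in the cutoff `w` in the admissible range `w₀ ≤ w ≤ ½ log log N` of §5, exactly as
  `GreenTao2010_gowersUniformity` is. "Bounded nilsequence with Lipschitz constant `M`" is taken
  `1`-bounded (divide by the bound). Functions on `[N]` are read off functions on `ℤ` (Gowers norm)
  or `ℕ` (orbit averages over `n ∈ [N] = {1, …, N}`); `[N] ↪ ℤ_{N'}` by reduction mod `N'`.
  Nilsequences are indexed by `n ∈ ℕ` (`gⁿ • x`); Prop. 10.1 prints `(F(gⁿx))_{n ∈ ℤ}` and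
  Prop. 10.2 `(F(gⁿx))_{n ∈ [N]}`, but only the terms `n ∈ [N]` enter either statement.
* Not here (later layers, see the session notes): `GI(s)` (Conj. 8.3 = Green–Tao–Ziegler 2012,
  Thm. 1.3), `MN(s)` (Conj. 8.5 = Green–Tao 2012, Thm. 1.1), Prop. 8.2, Prop. 10.3
  (Koopman–von Neumann), §§11–12, and the deductions Prop. 10.1 ⇐ `GI(s)`, Prop. 10.2 ⇐ `MN(s)`.

## References

* B. Green, T. Tao, *Linear equations in primes*, Ann. of Math. (2) 171 (2010), 1753–1850
  (arXiv:math/0606088): §5 (`w`, `W`, `Λ'_{b,W}`, Remark after Thm. 5.1), Prop. 6.4, Thm. 7.2,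
  Def. 8.1 and the Remarks following it, Conj. 8.3, Conj. 8.5 and the Remark following it,
  Prop. 10.1, Prop. 10.2 and the paragraph between them (proof of Thm. 7.2), proof of Prop. 10.1
  (end of §10), proof of Prop. 11.2 (Arzelà–Ascoli step).
* B. Green, T. Tao, *The Möbius function is strongly orthogonal to nilsequences*, Ann. of
  Math. (2) 175 (2012), 541–566, Thm. 1.1.
* B. Green, T. Tao, T. Ziegler, *An inverse theorem for the Gowers `U^{s+1}[N]`-norm*, Ann. of
  Math. (2) 176 (2012), 1231–1372, Conj. 1.2, Thm. 1.3.
-/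

noncomputable section

open Filter Finset
open scoped Manifold ContDiff

namespace Literature.NumberTheory.Sieve

/-! ### Nilmanifolds and nilsequences (Green–Tao 2010, Def. 8.1) -/

/-- **`s`-step nilmanifolds** (Green–Tao 2010, Def. 8.1, as printed: "Let `G` be a connected,
simply connected, Lie group. We define the central series `G_0 ⊇ G_1 ⊇ G_2 ⊇ …` by defining
`G_0 = G_1 = G`, and `G_{i+1} = [G, G_i]` …. We say that `G` is `s`-step nilpotent if
`G_{s+1} = {1}`. Let `Γ ⊆ G` be a discrete, cocompact subgroup. Then the quotient `G/Γ` is called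
an `s`-step nilmanifold."; and, before Conj. 8.3: "we shall arbitrarily endow each nilmanifold
`G/Γ` with a smooth Riemannian metric `d_{G/Γ}`", a nilmanifold being "a quadruplet
`(G, Γ, G/Γ, d_{G/Γ})`"). The Lie group is Mathlib's (`IsManifold` + `LieGroup`, smooth, modelled
on a finite-dimensional real normed space `E`); the metric is a metric on `G ⧸ Γ` inducing the
quotient topology (module docstring, "The metric"). [cite: GreenTao2010, Def. 8.1] -/
structure Nilmanifold (s : ℕ) : Type 1 where
  /-- the model vector space of the Lie group (`ℝ^{dim G}` up to isomorphism) -/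
  E : Type
  [instNormedAddCommGroup : NormedAddCommGroup E]
  [instNormedSpace : NormedSpace ℝ E]
  [instFiniteDimensional : FiniteDimensional ℝ E]
  /-- the connected, simply connected, `s`-step nilpotent Lie group `G` -/
  G : Type
  [instGroup : Group G]
  [instTopologicalSpace : TopologicalSpace G]
  [instT2Space : T2Space G]
  [instChartedSpace : ChartedSpace E G]
  [instIsManifold : IsManifold 𝓘(ℝ, E) ∞ G]
  [instLieGroup : LieGroup 𝓘(ℝ, E) ∞ G]
  [instConnectedSpace : ConnectedSpace G]
  [instSimplyConnectedSpace : SimplyConnectedSpace G]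
  /-- `G` is `s`-step nilpotent: `G_{s+1} = {1}` (`G_1 = G`, `G_{i+1} = [G, G_i]`) -/
  lowerCentralSeries_eq_bot : (⊤ : Subgroup G).lowerCentralSeries s = ⊥
  /-- the discrete cocompact subgroup `Γ` -/
  Γ : Subgroup G
  [instDiscreteTopology : DiscreteTopology Γ]
  [instCompactSpace : CompactSpace (G ⧸ Γ)]
  /-- the metric `d_{G/Γ}` on the nilmanifold `G/Γ` -/
  dist : G ⧸ Γ → G ⧸ Γ → ℝ
  dist_self : ∀ x, dist x x = 0
  dist_comm : ∀ x y, dist x y = dist y x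
  dist_triangle : ∀ x y z, dist x z ≤ dist x y + dist y z
  eq_of_dist_eq_zero : ∀ x y, dist x y = 0 → x = y
  /-- `d_{G/Γ}` induces the (quotient) topology of `G/Γ` -/
  isOpen_iff : ∀ U : Set (G ⧸ Γ), IsOpen U ↔ ∀ x ∈ U, ∃ ε : ℝ, 0 < ε ∧ ∀ y, dist x y < ε → y ∈ U

namespace Nilmanifold

variable {s : ℕ} (X : Nilmanifold s)

/-! The bundled structure instances, exposed for the carriers `X.E`, `X.G`, `X.Γ`, `X.G ⧸ X.Γ` of a
given nilmanifold `X` (they concern only these carriers and override nothing). -/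

/-- The model space of a nilmanifold's Lie group is a normed group. [folklore] -/
instance : NormedAddCommGroup X.E := X.instNormedAddCommGroup
/-- The model space of a nilmanifold's Lie group is a real normed space. [folklore] -/
instance : NormedSpace ℝ X.E := X.instNormedSpace
/-- The model space of a nilmanifold's Lie group is finite-dimensional. [folklore] -/
instance : FiniteDimensional ℝ X.E := X.instFiniteDimensional
/-- The Lie group `G` of a nilmanifold is a group. [cite: GreenTao2010, Def. 8.1] -/
instance : Group X.G := X.instGroup
/-- The Lie group `G` of a nilmanifold is a topological space. [cite: GreenTao2010, Def. 8.1] -/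
instance : TopologicalSpace X.G := X.instTopologicalSpace
/-- The Lie group `G` of a nilmanifold is Hausdorff. [cite: GreenTao2010, Def. 8.1] -/
instance : T2Space X.G := X.instT2Space
/-- The Lie group `G` of a nilmanifold is charted on its model space. [cite: GreenTao2010, Def. 8.1] -/
instance : ChartedSpace X.E X.G := X.instChartedSpace
/-- The Lie group `G` of a nilmanifold is a smooth manifold. [cite: GreenTao2010, Def. 8.1] -/
instance : IsManifold 𝓘(ℝ, X.E) ∞ X.G := X.instIsManifold
/-- The group `G` of a nilmanifold is a Lie group. [cite: GreenTao2010, Def. 8.1] -/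
instance : LieGroup 𝓘(ℝ, X.E) ∞ X.G := X.instLieGroup
/-- The Lie group `G` of a nilmanifold is connected. [cite: GreenTao2010, Def. 8.1] -/
instance : ConnectedSpace X.G := X.instConnectedSpace
/-- The Lie group `G` of a nilmanifold is simply connected. [cite: GreenTao2010, Def. 8.1] -/
instance : SimplyConnectedSpace X.G := X.instSimplyConnectedSpace
/-- The subgroup `Γ` of a nilmanifold is discrete. [cite: GreenTao2010, Def. 8.1] -/
instance : DiscreteTopology X.Γ := X.instDiscreteTopology
/-- A nilmanifold `G/Γ` is compact (`Γ` is cocompact). [cite: GreenTao2010, Def. 8.1] -/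
instance : CompactSpace (X.G ⧸ X.Γ) := X.instCompactSpace

/-- A Lie group is a topological group (Mathlib's `topologicalGroup_of_lieGroup`, which is not an
instance upstream because the model cannot be inferred; here the model is part of the data).
[folklore] -/
instance isTopologicalGroup : IsTopologicalGroup X.G :=
  topologicalGroup_of_lieGroup 𝓘(ℝ, X.E) ∞

/-- `d_{G/Γ} ≥ 0`. [folklore] -/
theorem dist_nonneg (x y : X.G ⧸ X.Γ) : 0 ≤ X.dist x y := by
  have h := X.dist_triangle x y x
  rw [X.dist_self, X.dist_comm y x] at h
  linarith

/-- The **`s`-step nilsequence** `(F(gⁿ x))_{n ∈ ℕ}` of a function `F : G/Γ → ℝ`, a group element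
`g ∈ G` and a point `x ∈ G/Γ` ("If `g ∈ G` then `g` acts on `G/Γ` by left multiplication,
`x ↦ g · x`. By an `s`-step nilsequence, we mean a sequence of the form `(F(gⁿ x))_{n ∈ ℕ}`, where
`x ∈ G/Γ` is a point and `F : G/Γ → ℝ` is a continuous function.").
[cite: GreenTao2010, Def. 8.1] -/
def nilsequence (F : X.G ⧸ X.Γ → ℝ) (g : X.G) (x : X.G ⧸ X.Γ) (n : ℕ) : ℝ :=
  F (g ^ n • x)

/-- `F(g⁰ x) = F(x)`. [folklore] -/
@[simp] theorem nilsequence_zero (F : X.G ⧸ X.Γ → ℝ) (g : X.G) (x : X.G ⧸ X.Γ) :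
    X.nilsequence F g x 0 = F x := by
  simp [nilsequence]

/-- Shifting a nilsequence by one step moves the base point: `F(gⁿ⁺¹ x) = F(gⁿ (g x))`.
[folklore] -/
theorem nilsequence_succ (F : X.G ⧸ X.Γ → ℝ) (g : X.G) (x : X.G ⧸ X.Γ) (n : ℕ) :
    X.nilsequence F g x (n + 1) = X.nilsequence F g (g • x) n := by
  simp [nilsequence, pow_succ, mul_smul]

/-- "`1`-bounded, with Lipschitz constant at most `M`": `F : G/Γ → [-1, 1]` and
`|F(y) - F(z)| ≤ M d_{G/Γ}(y, z)` ("We say that the nilsequence is `1`-bounded if `F` takes values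
in `[-1,1]`"; "We then define the Lipschitz constant of a nilsequence `F(gⁿx)` to be the
Lipschitz constant of `F`"). [cite: GreenTao2010, Def. 8.1 and the paragraph before Conj. 8.3] -/
def IsBoundedLipschitz (M : ℝ) (F : X.G ⧸ X.Γ → ℝ) : Prop :=
  (∀ y, |F y| ≤ 1) ∧ ∀ y z, |F y - F z| ≤ M * X.dist y z

/-- A Lipschitz function on `(G/Γ, d_{G/Γ})` is continuous for the topology of `G/Γ` (the metric
induces the topology), so a bounded Lipschitz `F` defines a nilsequence in the sense of Def. 8.1.
[folklore] -/
theorem IsBoundedLipschitz.continuous {X : Nilmanifold s} {M : ℝ} {F : X.G ⧸ X.Γ → ℝ}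
    (hF : X.IsBoundedLipschitz M F) : Continuous F := by
  rw [continuous_def]
  intro V hV
  rw [X.isOpen_iff]
  intro x hx
  obtain ⟨r, hr, hball⟩ := Metric.isOpen_iff.mp hV (F x) hx
  refine ⟨r / (|M| + 1), by positivity, fun y hy => hball ?_⟩
  rw [Metric.mem_ball, Real.dist_eq, abs_sub_comm]
  have hd := X.dist_nonneg x y
  have hlt : |M| * (r / (|M| + 1)) < r := by
    rw [mul_div_assoc', div_lt_iff₀ (by positivity)]
    nlinarith [abs_nonneg M]
  calc |F x - F y| ≤ M * X.dist x y := hF.2 x y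
    _ ≤ |M| * X.dist x y := mul_le_mul_of_nonneg_right (le_abs_self M) hd
    _ ≤ |M| * (r / (|M| + 1)) := mul_le_mul_of_nonneg_left hy.le (abs_nonneg M)
    _ < r := hlt

/-- The correlation average `𝔼_{n ∈ [N]} a(n) F(gⁿ x) = (1/N) ∑_{n=1}^{N} a(n) F(gⁿ x)` of a
sequence `a` with a nilsequence (junk `0` for `N = 0`).
[cite: GreenTao2010, Conj. 8.3 and Props. 10.1–10.2] -/
def orbitAverage (N : ℕ) (a : ℕ → ℝ) (F : X.G ⧸ X.Γ → ℝ) (g : X.G) (x : X.G ⧸ X.Γ) : ℝ :=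
  (∑ n ∈ Finset.Icc 1 N, a n * F (g ^ n • x)) / N

/-- The orbit average is the average of `a` against the nilsequence. [folklore] -/
theorem orbitAverage_eq_sum_nilsequence (N : ℕ) (a : ℕ → ℝ) (F : X.G ⧸ X.Γ → ℝ) (g : X.G)
    (x : X.G ⧸ X.Γ) :
    X.orbitAverage N a F g x = (∑ n ∈ Finset.Icc 1 N, a n * X.nilsequence F g x n) / N := rfl

/-- Linearity of the orbit average in the weight. [folklore] -/
theorem orbitAverage_sub (N : ℕ) (a a' : ℕ → ℝ) (F : X.G ⧸ X.Γ → ℝ) (g : X.G)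
    (x : X.G ⧸ X.Γ) :
    X.orbitAverage N (fun n => a n - a' n) F g x =
      X.orbitAverage N a F g x - X.orbitAverage N a' F g x := by
  simp only [orbitAverage, sub_mul, Finset.sum_sub_distrib, sub_div]

/-- Homogeneity of the orbit average in the weight. [folklore] -/
theorem orbitAverage_const_mul (N : ℕ) (r : ℝ) (a : ℕ → ℝ) (F : X.G ⧸ X.Γ → ℝ) (g : X.G)
    (x : X.G ⧸ X.Γ) :
    X.orbitAverage N (fun n => r * a n) F g x = r * X.orbitAverage N a F g x := by
  simp only [orbitAverage, mul_assoc, ← Finset.mul_sum, mul_div_assoc]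

/-- A weight supported on `[1, m)` and bounded by `B` on `[N]` has orbit average at most `m B / N`
in magnitude against a `1`-bounded function ("any error which is small in `L¹` norm will be easily
removed since the nilsequence is bounded", §11). [folklore] -/
theorem abs_orbitAverage_le_of_support {N m : ℕ} {B : ℝ} (hB : 0 ≤ B) {a : ℕ → ℝ}
    (ha : ∀ n, 1 ≤ n → n ≤ N → |a n| ≤ B) (ha0 : ∀ n, m ≤ n → a n = 0)
    {F : X.G ⧸ X.Γ → ℝ} (hF : ∀ y, |F y| ≤ 1) (g : X.G) (x : X.G ⧸ X.Γ) :
    |X.orbitAverage N a F g x| ≤ m * B / N := by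
  unfold orbitAverage
  rcases Nat.eq_zero_or_pos N with hN | hN
  · subst hN; simp
  have hNr : (0 : ℝ) < N := by exact_mod_cast hN
  rw [abs_div, abs_of_pos hNr]
  refine div_le_div_of_nonneg_right ?_ hNr.le
  have hsplit : ∑ n ∈ Finset.Icc 1 N, a n * F (g ^ n • x) =
      ∑ n ∈ (Finset.Icc 1 N).filter (fun n => n < m), a n * F (g ^ n • x) := by
    rw [Finset.sum_filter]
    refine Finset.sum_congr rfl fun n _ => ?_
    split_ifs with h
    · rfl
    · rw [ha0 n (not_lt.mp h), zero_mul]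
  rw [hsplit]
  calc |∑ n ∈ (Finset.Icc 1 N).filter (fun n => n < m), a n * F (g ^ n • x)|
      ≤ ∑ n ∈ (Finset.Icc 1 N).filter (fun n => n < m), |a n * F (g ^ n • x)| :=
        Finset.abs_sum_le_sum_abs _ _
    _ ≤ ∑ _n ∈ (Finset.Icc 1 N).filter (fun n => n < m), B := by
        refine Finset.sum_le_sum fun n hn => ?_
        have hI := Finset.mem_Icc.mp (Finset.mem_filter.mp hn).1
        rw [abs_mul]
        calc |a n| * |F (g ^ n • x)| ≤ B * 1 := mul_le_mul (ha n hI.1 hI.2) (hF _) (abs_nonneg _) hB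
          _ = B := mul_one B
    _ = ((Finset.Icc 1 N).filter (fun n => n < m)).card * B := by
        rw [Finset.sum_const, nsmul_eq_mul]
    _ ≤ m * B := by
        refine mul_le_mul_of_nonneg_right ?_ hB
        have hsub : (Finset.Icc 1 N).filter (fun n => n < m) ⊆ Finset.range m := fun n hn =>
          Finset.mem_range.mpr (Finset.mem_filter.mp hn).2
        calc (((Finset.Icc 1 N).filter (fun n => n < m)).card : ℝ) ≤ (Finset.range m).card := by
              exact_mod_cast Finset.card_le_card hsub
          _ = m := by rw [Finset.card_range]

/-- **The one-point nilmanifold** (non-vacuity of the structure, for every `s`): `G = ℝ⁰`, the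
trivial group — realised as the unit group of the zero ring `ℝ⁰ = (Fin 0 → ℝ)`, which Mathlib
knows to be a Lie group — is connected, simply connected and `s`-step nilpotent for every `s`;
`Γ = G`, and `G/Γ` is a point with the zero metric. (Its nilsequences are the constants.)
[folklore] -/
def point (s : ℕ) : Nilmanifold s where
  E := Fin 0 → ℝ
  G := (Fin 0 → ℝ)ˣ
  lowerCentralSeries_eq_bot := Subsingleton.elim _ _
  Γ := ⊤
  dist := fun _ _ => 0
  dist_self := fun _ => rfl
  dist_comm := fun _ _ => rfl
  dist_triangle := fun _ _ _ => by simp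
  eq_of_dist_eq_zero := fun x y _ =>
    haveI := @QuotientGroup.subsingleton_quotient_top ((Fin 0 → ℝ)ˣ) _
    Subsingleton.elim x y
  isOpen_iff := fun U =>
    haveI := @QuotientGroup.subsingleton_quotient_top ((Fin 0 → ℝ)ˣ) _
    ⟨fun _ x hx => ⟨1, one_pos, fun y _ => (Subsingleton.elim x y) ▸ hx⟩,
      fun _ => isOpen_discrete _⟩

/-- On the one-point nilmanifold every nilsequence is constant. [folklore] -/
theorem nilsequence_point (s : ℕ) (F : (point s).G ⧸ (point s).Γ → ℝ) (g : (point s).G)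
    (x : (point s).G ⧸ (point s).Γ) (n : ℕ) : (point s).nilsequence F g x n = F x := by
  haveI : Subsingleton ((point s).G ⧸ (point s).Γ) :=
    @QuotientGroup.subsingleton_quotient_top ((Fin 0 → ℝ)ˣ) _
  unfold nilsequence
  exact congrArg F (Subsingleton.elim _ _)

/-- An `s`-step nilmanifold is an `s'`-step nilmanifold for every `s' ≥ s` (the lower central
series is decreasing). [folklore] -/
def ofLE {s s' : ℕ} (X : Nilmanifold s) (h : s ≤ s') : Nilmanifold s' where
  E := X.E
  G := X.G
  lowerCentralSeries_eq_bot :=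
    le_bot_iff.mp (X.lowerCentralSeries_eq_bot ▸ Subgroup.lowerCentralSeries_antitone ⊤ h)
  Γ := X.Γ
  dist := X.dist
  dist_self := X.dist_self
  dist_comm := X.dist_comm
  dist_triangle := X.dist_triangle
  eq_of_dist_eq_zero := X.eq_of_dist_eq_zero
  isOpen_iff := X.isOpen_iff

/-- Raising the step does not change nilsequences. [folklore] -/
theorem nilsequence_ofLE {s s' : ℕ} (X : Nilmanifold s) (h : s ≤ s') (F : X.G ⧸ X.Γ → ℝ) (g : X.G)
    (x : X.G ⧸ X.Γ) : (X.ofLE h).nilsequence F g x = X.nilsequence F g x := rfl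

/-- Raising the step does not change orbit averages. [folklore] -/
theorem orbitAverage_ofLE {s s' : ℕ} (X : Nilmanifold s) (h : s ≤ s') (N : ℕ) (a : ℕ → ℝ)
    (F : X.G ⧸ X.Γ → ℝ) (g : X.G) (x : X.G ⧸ X.Γ) :
    (X.ofLE h).orbitAverage N a F g x = X.orbitAverage N a F g x := rfl

/-- Raising the step does not change the bounded-Lipschitz class. [folklore] -/
theorem isBoundedLipschitz_ofLE {s s' : ℕ} (X : Nilmanifold s) (h : s ≤ s') (M : ℝ)
    (F : X.G ⧸ X.Γ → ℝ) : (X.ofLE h).IsBoundedLipschitz M F ↔ X.IsBoundedLipschitz M F := Iff.rfl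

/-- In the multiplicative copy of `ℝ`, inversion is negation. [folklore] -/
theorem inv_eq_neg_mulR : (fun a : Multiplicative ℝ => a⁻¹) = (fun a : ℝ => -a) := rfl

/-- In the multiplicative copy of `ℝ`, multiplication is addition. [folklore] -/
theorem mul_eq_add_mulR :
    (fun p : Multiplicative ℝ × Multiplicative ℝ => p.1 * p.2) = (fun p : ℝ × ℝ => p.1 + p.2) := rfl

/-- `ℝ` (written multiplicatively) is `1`-step nilpotent, i.e. abelian: `G_2 = [G, G] = {1}`.
[folklore] -/
theorem lowerCentralSeries_one_mulR : (⊤ : Subgroup (Multiplicative ℝ)).lowerCentralSeries 1 = ⊥ := by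
  rw [Subgroup.lowerCentralSeries_succ, Subgroup.lowerCentralSeries_zero]
  exact Subgroup.commutator_eq_bot_iff_le_centralizer.mpr fun x _ =>
    Subgroup.mem_centralizer_iff.mpr fun g _ => mul_comm g x

/-- **The circle `ℝ/ℤ` as a `1`-step nilmanifold** ("in this case one can take `G/Γ` to just be
the standard unit circle `ℝ/ℤ`", Green–Tao on `GI(1)`): `G = ℝ` (written multiplicatively, with
its structure of a one-dimensional Lie group modelled on itself), `Γ = ℤ`, `G/Γ = ℝ/ℤ` with the
quotient metric of `AddCircle 1` (whose topology is the quotient topology). All the structure is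
transported from Mathlib's additive statements along the identification `Multiplicative ℝ = ℝ`.
[cite: GreenTao2010, discussion after Conj. 8.3] -/
def circle : Nilmanifold 1 where
  E := ℝ
  G := Multiplicative ℝ
  instT2Space := inferInstanceAs (T2Space ℝ)
  instChartedSpace := inferInstanceAs (ChartedSpace ℝ ℝ)
  instIsManifold := inferInstanceAs (IsManifold 𝓘(ℝ, ℝ) ∞ ℝ)
  instLieGroup :=
    letI : ChartedSpace ℝ (Multiplicative ℝ) := inferInstanceAs (ChartedSpace ℝ ℝ)
    { toIsManifold := inferInstanceAs (IsManifold 𝓘(ℝ, ℝ) ∞ ℝ)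
      contMDiff_mul := by rw [mul_eq_add_mulR]; exact contMDiff_add 𝓘(ℝ, ℝ) ∞ (G := ℝ)
      contMDiff_inv := by rw [inv_eq_neg_mulR]; exact contMDiff_neg 𝓘(ℝ, ℝ) ∞ (G := ℝ) }
  instConnectedSpace := inferInstanceAs (ConnectedSpace ℝ)
  instSimplyConnectedSpace := inferInstanceAs (SimplyConnectedSpace ℝ)
  lowerCentralSeries_eq_bot := lowerCentralSeries_one_mulR
  Γ := AddSubgroup.toSubgroup (AddSubgroup.zmultiples (1 : ℝ))
  instDiscreteTopology := inferInstanceAs (DiscreteTopology (AddSubgroup.zmultiples (1 : ℝ)))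
  instCompactSpace := inferInstanceAs (CompactSpace (AddCircle (1 : ℝ)))
  dist := fun x y => Dist.dist (α := AddCircle (1 : ℝ)) x y
  dist_self := fun x => _root_.dist_self (α := AddCircle (1 : ℝ)) x
  dist_comm := fun x y => _root_.dist_comm (α := AddCircle (1 : ℝ)) x y
  dist_triangle := fun x y z => _root_.dist_triangle (α := AddCircle (1 : ℝ)) x y z
  eq_of_dist_eq_zero := fun _ _ h => _root_.eq_of_dist_eq_zero (γ := AddCircle (1 : ℝ)) h
  isOpen_iff := fun U => by
    change IsOpen (X := AddCircle (1 : ℝ)) U ↔ _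
    rw [Metric.isOpen_iff]
    refine forall₂_congr fun x _ => exists_congr fun ε => and_congr_right fun _ => ?_
    simp only [Set.subset_def, Metric.mem_ball]
    constructor
    · intro h y hy; exact h y (by rwa [_root_.dist_comm])
    · intro h y hy; exact h y (by rwa [_root_.dist_comm])

/-- The points of the circle nilmanifold are the points of `AddCircle 1 = ℝ/ℤ`, and its metric is
the quotient metric of `ℝ/ℤ` (by construction). [folklore] -/
theorem circle_dist_eq (x y : circle.G ⧸ circle.Γ) :
    circle.dist x y = Dist.dist (α := AddCircle (1 : ℝ)) x y := rfl

/-- Nilsequences through a lifted base point: `F(gⁿ · hΓ) = F((gⁿh)Γ)`. [folklore] -/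
theorem nilsequence_mk {s : ℕ} (X : Nilmanifold s) (F : X.G ⧸ X.Γ → ℝ) (g h : X.G) (n : ℕ) :
    X.nilsequence F g (QuotientGroup.mk h) n = F (QuotientGroup.mk (g ^ n * h)) := rfl

/-- The rotation nilsequences on the circle: for `F : ℝ/ℤ → ℝ`, `g = θ ∈ ℝ` and `x = x₀ + ℤ`, the
nilsequence is `n ↦ F(x₀ + nθ + ℤ)`. [cite: GreenTao2010, discussion after Conj. 8.3] -/
theorem nilsequence_circle (F : circle.G ⧸ circle.Γ → ℝ) (θ x₀ : ℝ) (n : ℕ) :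
    circle.nilsequence F (Multiplicative.ofAdd θ) (QuotientGroup.mk (Multiplicative.ofAdd x₀)) n =
      F (QuotientGroup.mk (Multiplicative.ofAdd (x₀ + (n : ℝ) * θ))) := by
  rw [nilsequence_mk]
  exact congrArg (fun u : Multiplicative ℝ => F (QuotientGroup.mk u))
    (show (Multiplicative.ofAdd θ ^ n * Multiplicative.ofAdd x₀ : Multiplicative ℝ) =
        Multiplicative.ofAdd (x₀ + (n : ℝ) * θ) by
      rw [← ofAdd_nsmul, ← ofAdd_add, nsmul_eq_mul, add_comm])

end Nilmanifold

/-! ### The statements of Props. 10.1 and 10.2 (predicates of their parameters; not asserted) -/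

/-- **Relative inverse Gowers-norm theorem** (Green–Tao 2010, Prop. 10.1, as printed: "Assume the
`GI(s)` conjecture. For any `0 < δ ≤ 1` and any `C ≥ 20`, there exists a finite collection
`ℳ_{s,δ,C}` of nilmanifolds `G/Γ = (G/Γ, d_{G/Γ})` with the following property. Let `N ≥ 1`,
suppose that `N' ∈ [CN, 2CN]` is a prime, that `ν : ℤ_{N'} → ℝ⁺` is an
`(s+2)2^{s+1}`-pseudorandom measure, that `f : [N] → ℝ` is a function with `|f(n)| ≤ ν(n)` for all
`n ∈ [N]` and that `‖f‖_{U^{s+1}[N]} ≥ δ`. Then there exists `G/Γ ∈ ℳ_{s,δ,C}` together with a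
`1`-bounded `s`-step nilsequence `(F(gⁿx))_{n ∈ ℤ}` with Lipschitz constant `O_{s,δ,C}(1)`, such
that `|𝔼_{n ≤ N} f(n) F(gⁿ x)| ≫_{s,C,δ} 1`."). The hypothesis `GI(s)` (Conj. 8.3) is
Green–Tao–Ziegler 2012, Thm. 1.3. This `def` is the printed assertion for the parameters `s`
(level), `δ`, `C` and the moment constants `A` of the pseudorandomness notion — a predicate, not
a claim: Green–Tao prove it for all `s ≥ 1`, `0 < δ ≤ 1`, `C ≥ 20` (and all `A`), which this file
does NOT assert (module docstring, "Debt discipline"). Quantitative rendering (module docstring):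
pseudorandomness with explicit error `η` and moment constants `A` (`IsPseudorandomMeasure`), the
finite family indexed by `Fin m`, constants allowed to depend on `A`, and a threshold `N₀` in
place of the `o(1)`-reading of "Let `N ≥ 1`"; nilmanifolds carry compatible metrics (a weakening
of the existential statement). [cite: GreenTao2010, Prop. 10.1] -/
def GreenTao2010_relativeInverseAt (s : ℕ) (δ C : ℝ) (A : ℕ → ℝ → ℝ) : Prop :=
  ∃ (m : ℕ) (𝓜 : Fin m → Nilmanifold s) (M c η : ℝ) (N₀ : ℕ), 0 < c ∧ 0 < η ∧
    ∀ N : ℕ, N₀ ≤ N →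
      ∀ (N' : ℕ) [NeZero N'], N'.Prime → C * N ≤ (N' : ℝ) → (N' : ℝ) ≤ 2 * C * N →
        ∀ ν : ZMod N' → ℝ, IsPseudorandomMeasure ((s + 2) * 2 ^ (s + 1)) η A ν →
          ∀ f : ℤ → ℝ, (∀ n : ℤ, 1 ≤ n → n ≤ N → |f n| ≤ ν (n : ZMod N')) →
            δ ≤ uniformityNorm (s + 1) N (fun n => ((f n : ℝ) : ℂ)) →
              ∃ (i : Fin m) (g : (𝓜 i).G) (x : (𝓜 i).G ⧸ (𝓜 i).Γ)
                (F : (𝓜 i).G ⧸ (𝓜 i).Γ → ℝ),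
                (𝓜 i).IsBoundedLipschitz M F ∧
                  c ≤ |(𝓜 i).orbitAverage N (fun n => f n) F g x|

/-- **`W`-tricked von Mangoldt orthogonal to nilsequences** (Green–Tao 2010, Prop. 10.2, as
printed: "Let `s ≥ 1`, and assume the `MN(s)` conjecture. Let `G/Γ = (G/Γ, d_{G/Γ})` be an
`s`-step nilmanifold with smooth metric `d_{G/Γ}`, and let `(F(gⁿ x))_{n ∈ [N]}` be a bounded
`s`-step nilsequence with Lipschitz constant `M`. Let `b ∈ [W]` be coprime to `W`. Then we have
the bound `𝔼_{n ∈ [N]} (Λ'_{b,W}(n) - 1) F(gⁿ x) = o_{M,G/Γ,s}(1)`."; the implied decay is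
uniform in `g`, `x` (Remark after Conj. 8.5), in `b` (Remark after Thm. 5.1) and in the cutoff
`w` of §5). The hypothesis `MN(s)` (Conj. 8.5) is Green–Tao 2012, Thm. 1.1. This `def` is the
printed assertion for the level `s`, the nilmanifold `X = G/Γ` and the Lipschitz bound `M` — a
predicate, not a claim: Green–Tao prove it for all `s ≥ 1`, `G/Γ`, `M`, which this file does NOT
assert (module docstring, "Debt discipline"). Rendered: for every `ε > 0` there are `w₀, N₀`
with `|𝔼_{n ∈ [N]} (Λ'_{b,W}(n) - 1) F(gⁿ x)| ≤ ε` whenever `N ≥ N₀`, `w₀ ≤ w ≤ ½ log log N`,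
`W = ∏_{p ≤ w} p`, `b ∈ [W]` coprime to `W`, `F : G/Γ → [-1,1]` has Lipschitz constant `≤ M`,
`g ∈ G`, `x ∈ G/Γ` (compatible metric; equivalent to the smooth-metric statement by the
compactness argument of the module docstring). [cite: GreenTao2010, Prop. 10.2] -/
def GreenTao2010_nilsequenceOrthogonalityAt (s : ℕ) (X : Nilmanifold s) (M : ℝ) : Prop :=
  ∀ ε : ℝ, 0 < ε → ∃ w₀ N₀ : ℕ, ∀ N : ℕ, N₀ ≤ N →
    ∀ w : ℕ, w₀ ≤ w → (w : ℝ) ≤ Real.log (Real.log N) / 2 →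
      ∀ b : ℕ, 1 ≤ b → b ≤ primorial w → Nat.Coprime b (primorial w) →
        ∀ (g : X.G) (x : X.G ⧸ X.Γ) (F : X.G ⧸ X.Γ → ℝ), X.IsBoundedLipschitz M F →
          |X.orbitAverage N (fun n => vonMangoldtW (primorial w) b n - 1) F g x| ≤ ε

/-! ### Thm. 7.2 from Props. 6.4, 10.1 and 10.2 (proved) -/

/-- The conclusion of Prop. 10.1 at `(s, δ, C, A)` for a given finite family `𝓜`, Lipschitz bound
`M`, correlation bound `c`, pseudorandomness error `η` and threshold `N₀` (the body of
`GreenTao2010_relativeInverseAt` after its existential quantifiers, so that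
`GreenTao2010_relativeInverseAt s δ C A ↔ ∃ m 𝓜 M c η N₀, GreenTao2010_relativeInverseDatum …`,
`GreenTao2010_relativeInverseAt_iff`). Isolating it lets Thm. 7.2 be assembled with Prop. 10.2
required only for the members of the family (`GreenTao2010_gowersUniformityAt_of_local`).
[cite: GreenTao2010, Prop. 10.1] -/
def GreenTao2010_relativeInverseDatum (s : ℕ) (δ C : ℝ) (A : ℕ → ℝ → ℝ) {m : ℕ}
    (𝓜 : Fin m → Nilmanifold s) (M c η : ℝ) (N₀ : ℕ) : Prop :=
  0 < c ∧ 0 < η ∧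
    ∀ N : ℕ, N₀ ≤ N →
      ∀ (N' : ℕ) [NeZero N'], N'.Prime → C * N ≤ (N' : ℝ) → (N' : ℝ) ≤ 2 * C * N →
        ∀ ν : ZMod N' → ℝ, IsPseudorandomMeasure ((s + 2) * 2 ^ (s + 1)) η A ν →
          ∀ f : ℤ → ℝ, (∀ n : ℤ, 1 ≤ n → n ≤ N → |f n| ≤ ν (n : ZMod N')) →
            δ ≤ uniformityNorm (s + 1) N (fun n => ((f n : ℝ) : ℂ)) →
              ∃ (i : Fin m) (g : (𝓜 i).G) (x : (𝓜 i).G ⧸ (𝓜 i).Γ)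
                (F : (𝓜 i).G ⧸ (𝓜 i).Γ → ℝ),
                (𝓜 i).IsBoundedLipschitz M F ∧
                  c ≤ |(𝓜 i).orbitAverage N (fun n => f n) F g x|

/-- `GreenTao2010_relativeInverseAt` is the existence of a relative inverse datum. [folklore] -/
theorem GreenTao2010_relativeInverseAt_iff (s : ℕ) (δ C : ℝ) (A : ℕ → ℝ → ℝ) :
    GreenTao2010_relativeInverseAt s δ C A ↔
      ∃ (m : ℕ) (𝓜 : Fin m → Nilmanifold s) (M c η : ℝ) (N₀ : ℕ),
        GreenTao2010_relativeInverseDatum s δ C A 𝓜 M c η N₀ :=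
  Iff.rfl

/-- **Proof of Theorem 7.2 from Propositions 6.4, 10.1 and 10.2, with Prop. 10.2 localised to the
family of Prop. 10.1** (Green–Tao 2010, §10, the paragraph before Prop. 10.2: Prop. 10.2 is only
ever "applied to the finitely many members" of the family `ℳ_{s,δ,C}` produced by Prop. 10.1 at
the Lipschitz constant it produces). Same proof as `GreenTao2010_gowersUniformityAt_of_props`
below, which is its special case. [cite: GreenTao2010, §10 (proof of Thm. 7.2 before Prop. 10.2),
Prop. 6.4, Prop. 10.1, Prop. 10.2] -/
theorem GreenTao2010_gowersUniformityAt_of_local {s : ℕ} (hs : 1 ≤ s)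
    (h64 : GreenTao2010_pseudorandomDomination)
    (hloc : ∀ δ : ℝ, 0 < δ → δ ≤ 1 → ∀ C : ℝ, 20 ≤ C → ∀ A : ℕ → ℝ → ℝ,
      ∃ (m : ℕ) (𝓜 : Fin m → Nilmanifold s) (Mlip c η : ℝ) (N₀ : ℕ),
        GreenTao2010_relativeInverseDatum s δ C A 𝓜 Mlip c η N₀ ∧
          ∀ i : Fin m, GreenTao2010_nilsequenceOrthogonalityAt s (𝓜 i) Mlip) :
    GreenTao2010_gowersUniformityAt s := by
  intro ε hε
  -- Prop. 6.4 with `t = 1`, `D = (s+2)2^{s+1}`, and `C = max(C₀(D), 20)`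
  have hD2 : 2 ≤ (s + 2) * 2 ^ (s + 1) := by
    calc 2 = 1 * 2 ^ 1 := by norm_num
      _ ≤ (s + 2) * 2 ^ (s + 1) :=
          Nat.mul_le_mul (by omega) (Nat.pow_le_pow_right (by norm_num) (by omega))
  obtain ⟨C₀, hC₀, H64⟩ := h64 ((s + 2) * 2 ^ (s + 1)) 1 hD2 le_rfl
  obtain ⟨C, hCdef⟩ : ∃ C : ℝ, C = max C₀ 20 := ⟨_, rfl⟩
  have hC₀C : C₀ ≤ C := by rw [hCdef]; exact le_max_left _ _
  have h20C : (20 : ℝ) ≤ C := by rw [hCdef]; exact le_max_right _ _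
  have hC0 : 0 < C := by linarith
  obtain ⟨M, hM, A, H64'⟩ := H64 C hC₀C
  -- Prop. 10.1 with `δ = min(ε / 2M, 1)`
  obtain ⟨δ, hδdef⟩ : ∃ δ : ℝ, δ = min (M⁻¹ * ε / 2) 1 := ⟨_, rfl⟩
  have hδ0 : 0 < δ := by rw [hδdef]; exact lt_min (by positivity) one_pos
  have hδ1 : δ ≤ 1 := by rw [hδdef]; exact min_le_right _ _
  have hδε : δ ≤ M⁻¹ * ε / 2 := by rw [hδdef]; exact min_le_left _ _
  obtain ⟨m, 𝓜, Mlip, c, η, N₁, ⟨hc, hη, H101⟩, H102loc⟩ := hloc δ hδ0 hδ1 C h20C A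
  -- Prop. 10.2 for each member of the family, with tolerance `c M / 4`
  have hcM : 0 < c * M / 4 := by positivity
  choose w₂ N₂ H102 using fun i : Fin m => H102loc i (c * M / 4) hcM
  -- Prop. 6.4 at the error `η` of Prop. 10.1
  obtain ⟨w₃, N₃, H64''⟩ := H64' η hη
  -- thresholds making the two cuts at `N^{3/5}` harmless
  obtain ⟨N₄, hN₄⟩ := logPow_cut_eventually
    (mul_nonneg (gowersPerturbConst_pos (s + 1)).le (by positivity) :
      (0 : ℝ) ≤ gowersPerturbConst (s + 1) * M⁻¹ ^ 2 ^ (s + 1))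
    (by positivity : (0 : ℝ) < (M⁻¹ * ε / 2) ^ 2 ^ (s + 1)) (2 ^ (s + 1))
  obtain ⟨N₅, hN₅⟩ := logPow_cut_eventually zero_le_one hcM 1
  obtain ⟨F₀, hF₀⟩ : ∃ F₀ : ℕ, F₀ = ⌈1 / C⌉₊ := ⟨_, rfl⟩
  refine ⟨(∑ i, w₂ i) + w₃, N₁ + (∑ i, N₂ i) + N₃ + N₄ + N₅ + F₀ + 2 * s + 4, ?_⟩
  intro N hN w hw hwN b hb1 hbW hbcop
  by_contra hcon
  push Not at hcon
  have hN₁N : N₁ ≤ N := by omega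
  have hN₃N : N₃ ≤ N := by omega
  have hN₄N : N₄ ≤ N := by omega
  have hN₅N : N₅ ≤ N := by omega
  have hF₀N : F₀ ≤ N := by omega
  have hNk : 2 * (s + 1 + 1) ≤ N := by omega
  have hN2 : 2 ≤ N := by omega
  have hw₃ : w₃ ≤ w := by omega
  have hN₂N : ∀ i, N₂ i ≤ N := fun i =>
    (Finset.single_le_sum (fun j _ => Nat.zero_le (N₂ j)) (Finset.mem_univ i)).trans (by omega)
  have hw₂ : ∀ i, w₂ i ≤ w := fun i =>
    (Finset.single_le_sum (fun j _ => Nat.zero_le (w₂ j)) (Finset.mem_univ i)).trans (by omega)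
  have hNr1 : (1 : ℝ) ≤ N := by exact_mod_cast (by omega : 1 ≤ N)
  have hNr0 : (0 : ℝ) < N := by linarith
  have hWN : primorial w ≤ N := by exact_mod_cast primorial_le_of_le_logLog hN2 hwN
  -- a prime `N' = p ∈ [CN, 2CN]` (Bertrand)
  have hCN : 1 ≤ C * N := by
    have hF1 : 1 / C ≤ F₀ := by rw [hF₀]; exact Nat.le_ceil _
    have hFN : (F₀ : ℝ) ≤ N := by exact_mod_cast hF₀N
    calc (1 : ℝ) = C * (1 / C) := by field_simp
      _ ≤ C * N := mul_le_mul_of_nonneg_left (hF1.trans hFN) hC0.le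
  obtain ⟨p, hp, hCp, hp2⟩ := exists_prime_mem_Icc hCN
  haveI : NeZero p := ⟨hp.ne_zero⟩
  -- the pseudorandom majorant of `1 + Λ'_{b,W}` on `[N^{3/5}, N]`
  obtain ⟨ν, hν, hdom⟩ := H64'' N hN₃N w hw₃ hwN p hp hCp hp2 (fun _ : Fin 1 => b)
    (fun _ => ⟨hb1, hbW, hbcop⟩)
  simp only [Finset.univ_unique, Finset.sum_singleton] at hdom
  -- the cut-off `m = ⌈N^{3/5}⌉`
  set m : ℕ := ⌈(N : ℝ) ^ ((3 : ℝ) / 5)⌉₊ with hm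
  have hm35 : (N : ℝ) ^ ((3 : ℝ) / 5) ≤ m := Nat.le_ceil _
  have hm1 : (m : ℝ) ≤ (N : ℝ) ^ ((3 : ℝ) / 5) + 1 := (Nat.ceil_lt_add_one (by positivity)).le
  -- the function `f = M⁻¹ (Λ'_{b,W} - 1) 1_{[m, ∞)}`, dominated by `ν` on `[N]`
  set f : ℤ → ℝ := fun x =>
    if (m : ℤ) ≤ x then M⁻¹ * (vonMangoldtW (primorial w) b x.toNat - 1) else 0 with hf
  have hfν : ∀ x : ℤ, 1 ≤ x → x ≤ N → |f x| ≤ ν (x : ZMod p) := by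
    intro x hx1 hxN
    by_cases hmx : (m : ℤ) ≤ x
    · have hx0 : 0 ≤ x := by omega
      have hxnat : ((x.toNat : ℕ) : ℤ) = x := Int.toNat_of_nonneg hx0
      have h35 : (N : ℝ) ^ ((3 : ℝ) / 5) ≤ (x.toNat : ℕ) := by
        have h2 : (m : ℝ) ≤ (x.toNat : ℕ) := by
          have : (m : ℤ) ≤ (x.toNat : ℤ) := by rw [hxnat]; exact hmx
          exact_mod_cast this
        linarith
      have hxN' : x.toNat ≤ N := by omega
      have hd := hdom x.toNat h35 hxN'
      have hcast : ((x : ℤ) : ZMod p) = ((x.toNat : ℕ) : ZMod p) := by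
        conv_lhs => rw [← hxnat]
        exact Int.cast_natCast _
      have hf' : f x = M⁻¹ * (vonMangoldtW (primorial w) b x.toNat - 1) := by
        simp [hf, hmx]
      have hΛ0 := (vonMangoldtW_nonneg_le_log (primorial w) b x.toNat).1
      have h1 : |vonMangoldtW (primorial w) b x.toNat - 1| ≤
          1 + vonMangoldtW (primorial w) b x.toNat := by
        rw [abs_le]; constructor <;> linarith
      rw [hf', abs_mul, abs_of_pos (inv_pos.mpr hM), hcast]
      calc M⁻¹ * |vonMangoldtW (primorial w) b x.toNat - 1|
          ≤ M⁻¹ * (1 + vonMangoldtW (primorial w) b x.toNat) :=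
            mul_le_mul_of_nonneg_left h1 (inv_nonneg.mpr hM.le)
        _ ≤ M⁻¹ * (M * ν ((x.toNat : ℕ) : ZMod p)) :=
            mul_le_mul_of_nonneg_left hd (inv_nonneg.mpr hM.le)
        _ = ν _ := by field_simp
    · have : f x = 0 := by simp [hf, hmx]
      rw [this, abs_zero]
      exact hν.1 _
  -- the Gowers norm of `f` is at least `δ`: Thm. 7.2 fails at scale `N`, and the cut is small
  have hgowers : δ ≤ uniformityNorm (s + 1) N (fun n => ((f n : ℝ) : ℂ)) := by
    set G : ℤ → ℂ := fun n => ((M⁻¹ : ℝ) : ℂ) * vonMangoldtWSubOne (primorial w) b n with hG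
    have hlogN : 0 ≤ Real.log ((N : ℝ) + 1) := Real.log_nonneg (by linarith)
    set B₀ : ℝ := M⁻¹ * (1 + 2 * Real.log ((N : ℝ) + 1)) with hB₀
    have hB₀0 : 0 ≤ B₀ := mul_nonneg (inv_nonneg.mpr hM.le) (by linarith)
    have hGbd : ∀ x : ℤ, 1 ≤ x → x ≤ N → ‖G x‖ ≤ B₀ := by
      intro x hx1 hxN
      simp only [hG, vonMangoldtWSubOne, norm_mul, Complex.norm_real, Real.norm_eq_abs,
        abs_of_pos (inv_pos.mpr hM)]
      exact mul_le_mul_of_nonneg_left (abs_vonMangoldtW_sub_one_le hWN hbW hx1 hxN)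
        (inv_nonneg.mpr hM.le)
    have hFG' : ∀ x : ℤ, (m : ℤ) ≤ x → ((f x : ℝ) : ℂ) = G x := by
      intro x hmx
      have : f x = M⁻¹ * (vonMangoldtW (primorial w) b x.toNat - 1) := by simp [hf, hmx]
      rw [this]
      simp only [hG, vonMangoldtWSubOne]
      push_cast
      ring
    have hFbd : ∀ x : ℤ, 1 ≤ x → x ≤ N → ‖((f x : ℝ) : ℂ)‖ ≤ B₀ := by
      intro x hx1 hxN
      by_cases hmx : (m : ℤ) ≤ x
      · rw [hFG' x hmx]; exact hGbd x hx1 hxN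
      · have : f x = 0 := by simp [hf, hmx]
        rw [this]; simpa using hB₀0
    have hFG : ∀ x : ℤ, (m : ℤ) < x → x ≤ N → ((f x : ℝ) : ℂ) = G x :=
      fun x hmx _ => hFG' x hmx.le
    have hpert := norm_uniformityAvg_sub_le (k := s + 1) hNk hB₀0 hFbd hGbd hFG
    have hΔ : gowersPerturbConst (s + 1) * B₀ ^ 2 ^ (s + 1) * m / N ≤
        (M⁻¹ * ε / 2) ^ 2 ^ (s + 1) := by
      have h4 := hN₄ N hN₄N
      have ha0 : 0 ≤ gowersPerturbConst (s + 1) * M⁻¹ ^ 2 ^ (s + 1) *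
          (1 + 2 * Real.log ((N : ℝ) + 1)) ^ 2 ^ (s + 1) :=
        mul_nonneg (mul_nonneg (gowersPerturbConst_pos _).le (by positivity))
          (pow_nonneg (by linarith) _)
      calc gowersPerturbConst (s + 1) * B₀ ^ 2 ^ (s + 1) * m / N
          = gowersPerturbConst (s + 1) * M⁻¹ ^ 2 ^ (s + 1) *
              (1 + 2 * Real.log ((N : ℝ) + 1)) ^ 2 ^ (s + 1) * m / N := by
            rw [hB₀, mul_pow]; ring
        _ ≤ gowersPerturbConst (s + 1) * M⁻¹ ^ 2 ^ (s + 1) *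
              (1 + 2 * Real.log ((N : ℝ) + 1)) ^ 2 ^ (s + 1) *
              ((N : ℝ) ^ ((3 : ℝ) / 5) + 1) / N :=
            div_le_div_of_nonneg_right (mul_le_mul_of_nonneg_left hm1 ha0) hNr0.le
        _ ≤ (M⁻¹ * ε / 2) ^ 2 ^ (s + 1) := h4
    have hpert' : ‖uniformityAvg (s + 1) N G -
        uniformityAvg (s + 1) N (fun n => ((f n : ℝ) : ℂ))‖ ≤ (M⁻¹ * ε / 2) ^ 2 ^ (s + 1) := by
      rw [norm_sub_rev]; exact hpert.trans hΔ
    have hnorm := uniformityNorm_le_add_rpow (by positivity) hpert'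
    have hGnorm : uniformityNorm (s + 1) N G =
        M⁻¹ * uniformityNorm (s + 1) N (vonMangoldtWSubOne (primorial w) b) :=
      uniformityNorm_ofReal_mul (s + 1) N (inv_nonneg.mpr hM.le) _
    have hroot : ((M⁻¹ * ε / 2) ^ 2 ^ (s + 1)) ^ ((2 : ℝ) ^ (s + 1))⁻¹ = M⁻¹ * ε / 2 := by
      have h2 : ((2 : ℝ) ^ (s + 1)) = ((2 ^ (s + 1) : ℕ) : ℝ) := by push_cast; ring
      rw [h2, Real.pow_rpow_inv_natCast (by positivity) (by positivity)]
    rw [hGnorm, hroot] at hnorm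
    have hlow : M⁻¹ * ε < M⁻¹ * uniformityNorm (s + 1) N (vonMangoldtWSubOne (primorial w) b) :=
      mul_lt_mul_of_pos_left hcon (inv_pos.mpr hM)
    linarith
  -- Prop. 10.1: `f` correlates with a nilsequence from the family …
  obtain ⟨i, g, x, F, hF, hcorr⟩ := H101 N hN₁N p hp hCp hp2 ν hν f hfν hgowers
  -- … while by Prop. 10.2 `Λ'_{b,W} - 1` does not
  have horth := H102 i N (hN₂N i) w (hw₂ i) hwN b hb1 hbW hbcop g x F hF
  -- the two orbit averages differ by the normalisation `M⁻¹` and the cut at `m`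
  set a₂ : ℕ → ℝ := fun n => vonMangoldtW (primorial w) b n - 1 with ha₂
  set a₀ : ℕ → ℝ := fun n => if n < m then M⁻¹ * a₂ n else 0 with ha₀
  have hfa : (fun n : ℕ => f n) = fun n => M⁻¹ * a₂ n - a₀ n := by
    funext n
    by_cases hnm : n < m
    · have : ¬ ((m : ℤ) ≤ (n : ℤ)) := by exact_mod_cast not_le.mpr hnm
      simp [hf, ha₀, this, hnm]
    · have : (m : ℤ) ≤ (n : ℤ) := by exact_mod_cast not_lt.mp hnm
      simp [hf, ha₀, ha₂, this, hnm, Int.toNat_natCast]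
  have hlog1 : 0 ≤ 1 + 2 * Real.log ((N : ℝ) + 1) := by
    have : 0 ≤ Real.log ((N : ℝ) + 1) := Real.log_nonneg (by linarith)
    linarith
  have hB : 0 ≤ M⁻¹ * (1 + 2 * Real.log ((N : ℝ) + 1)) :=
    mul_nonneg (inv_nonneg.mpr hM.le) hlog1
  have ha₀bd : ∀ n, 1 ≤ n → n ≤ N → |a₀ n| ≤ M⁻¹ * (1 + 2 * Real.log ((N : ℝ) + 1)) := by
    intro n hn1 hnN
    by_cases hnm : n < m
    · simp only [ha₀, hnm, if_true, abs_mul, abs_of_pos (inv_pos.mpr hM)]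
      refine mul_le_mul_of_nonneg_left ?_ (inv_nonneg.mpr hM.le)
      have := abs_vonMangoldtW_sub_one_le hWN hbW (x := (n : ℤ)) (by exact_mod_cast hn1)
        (by exact_mod_cast hnN)
      simpa [ha₂, Int.toNat_natCast] using this
    · simp only [ha₀, hnm, if_false, abs_zero]; exact hB
  have ha₀0 : ∀ n, m ≤ n → a₀ n = 0 := fun n hn => by simp [ha₀, not_lt.mpr hn]
  have hcut := (𝓜 i).abs_orbitAverage_le_of_support hB ha₀bd ha₀0 hF.1 g x
  have hsmall : (m : ℝ) * (M⁻¹ * (1 + 2 * Real.log ((N : ℝ) + 1))) / N ≤ M⁻¹ * (c * M / 4) := by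
    have h5 := hN₅ N hN₅N
    calc (m : ℝ) * (M⁻¹ * (1 + 2 * Real.log ((N : ℝ) + 1))) / N
        = M⁻¹ * ((1 + 2 * Real.log ((N : ℝ) + 1)) * m / N) := by ring
      _ ≤ M⁻¹ * (1 * (1 + 2 * Real.log ((N : ℝ) + 1)) ^ 1 * ((N : ℝ) ^ ((3 : ℝ) / 5) + 1) / N) := by
          refine mul_le_mul_of_nonneg_left ?_ (inv_nonneg.mpr hM.le)
          rw [one_mul, pow_one]
          exact div_le_div_of_nonneg_right (mul_le_mul_of_nonneg_left hm1 hlog1) hNr0.le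
      _ ≤ M⁻¹ * (c * M / 4) := mul_le_mul_of_nonneg_left h5 (inv_nonneg.mpr hM.le)
  have hdecomp : (𝓜 i).orbitAverage N (fun n : ℕ => f n) F g x =
      M⁻¹ * (𝓜 i).orbitAverage N a₂ F g x - (𝓜 i).orbitAverage N a₀ F g x := by
    rw [hfa, (𝓜 i).orbitAverage_sub, (𝓜 i).orbitAverage_const_mul]
  have hfinal : c ≤ c / 2 := by
    calc c ≤ |(𝓜 i).orbitAverage N (fun n : ℕ => f n) F g x| := hcorr
      _ = |M⁻¹ * (𝓜 i).orbitAverage N a₂ F g x - (𝓜 i).orbitAverage N a₀ F g x| := by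
          rw [hdecomp]
      _ ≤ |M⁻¹ * (𝓜 i).orbitAverage N a₂ F g x| + |(𝓜 i).orbitAverage N a₀ F g x| :=
          abs_sub _ _
      _ = M⁻¹ * |(𝓜 i).orbitAverage N a₂ F g x| + |(𝓜 i).orbitAverage N a₀ F g x| := by
          rw [abs_mul, abs_of_pos (inv_pos.mpr hM)]
      _ ≤ M⁻¹ * (c * M / 4) + M⁻¹ * (c * M / 4) :=
          add_le_add (mul_le_mul_of_nonneg_left horth (inv_nonneg.mpr hM.le)) (hcut.trans hsmall)
      _ = c / 2 := by field_simp; ring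
  linarith

/-- **Proof of Theorem 7.2 from Propositions 6.4, 10.1 and 10.2** (Green–Tao 2010, §10, the
paragraph before Prop. 10.2, as printed: "In view of Proposition 10.1 and Proposition 6.4, it is
not hard to see that Theorem 7.2, and hence the Main Theorem, follows from the next proposition.
All one need do is choose `C := max(C₀((s+2)2^{s+1}), 20)`, where `C₀` is the function appearing
in Proposition 6.4. This ensures that an appropriate pseudorandom measure `ν` can be
constructed."). The formal proof (module docstring) runs the contrapositive at each scale:
`D = (s+2)2^{s+1}`, `t = 1`, `C = max(C₀, 20)`, a prime `N' ∈ [CN, 2CN]` (Bertrand), the measure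
`ν` of Prop. 6.4 dominating `f = M⁻¹(Λ'_{b,W} - 1) 1_{[⌈N^{3/5}⌉, N]}`, the effect of the cut on
`‖·‖_{U^{s+1}[N]}` and on the correlation being `o(1)`; Prop. 10.1 at `δ = min(ε/2M, 1)` produces
a correlating nilsequence from a finite family, contradicting Prop. 10.2 applied to the finitely
many members. [cite: GreenTao2010, §10 (proof of Thm. 7.2 before Prop. 10.2), Prop. 6.4,
Prop. 10.1, Prop. 10.2] -/
theorem GreenTao2010_gowersUniformityAt_of_props {s : ℕ} (hs : 1 ≤ s)
    (h64 : GreenTao2010_pseudorandomDomination)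
    (h101 : ∀ δ : ℝ, 0 < δ → δ ≤ 1 → ∀ C : ℝ, 20 ≤ C → ∀ A : ℕ → ℝ → ℝ,
      GreenTao2010_relativeInverseAt s δ C A)
    (h102 : ∀ (X : Nilmanifold s) (M : ℝ), GreenTao2010_nilsequenceOrthogonalityAt s X M) :
    GreenTao2010_gowersUniformityAt s :=
  GreenTao2010_gowersUniformityAt_of_local hs h64 fun δ hδ hδ1 C hC A => by
    obtain ⟨m, 𝓜, Mlip, c, η, N₀, hd⟩ := h101 δ hδ hδ1 C hC A
    exact ⟨m, 𝓜, Mlip, c, η, N₀, hd, fun i => h102 (𝓜 i) Mlip⟩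

/-- **Thm. 7.2 for all `s ≥ 1` from Props. 6.4, 10.1, 10.2 for all `s ≥ 1`**: the conjunction
over the levels of `GreenTao2010_gowersUniformityAt_of_props`
(`GreenTao2010_gowersUniformity_iff`). With `GreenTao2010_pseudorandomDomination_holds`
(`LinearEquationsInPrimesEnvelopingSieveDomination.lean`) supplying `h64`, the Gowers uniformity
estimate — and with it the Green–Tao–Ziegler theorem
(`GreenTaoZiegler2012_finiteComplexity_of_gowersUniformity`) — rests on Props. 10.1 and 10.2,
i.e. on `GI(s)` and `MN(s)` through §§10–12 of the paper.
[cite: GreenTao2010, Thm. 7.2 and §10 (proof of Thm. 7.2 before Prop. 10.2)] -/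
theorem GreenTao2010_gowersUniformity_of_props (h64 : GreenTao2010_pseudorandomDomination)
    (h101 : ∀ s : ℕ, 1 ≤ s → ∀ δ : ℝ, 0 < δ → δ ≤ 1 → ∀ C : ℝ, 20 ≤ C → ∀ A : ℕ → ℝ → ℝ,
      GreenTao2010_relativeInverseAt s δ C A)
    (h102 : ∀ s : ℕ, 1 ≤ s → ∀ (X : Nilmanifold s) (M : ℝ),
      GreenTao2010_nilsequenceOrthogonalityAt s X M) :
    GreenTao2010_gowersUniformity :=
  GreenTao2010_gowersUniformity_iff.mpr fun s hs =>
    GreenTao2010_gowersUniformityAt_of_props hs h64 (h101 s hs) (h102 s hs)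

end Literature.NumberTheory.Sieve
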